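import Summits.MatrixMultiplication.OmegaCensus.STPPSmallPatternKernelReflect122R

/-!
# ω-census, small STPP pattern `(1,2,2)^k`: min-flag normal form with a SECOND STABILISER LEVEL (the code of `b₁`)

HONEST FRAMING (pub-omega census; verbatim): lottery ticket; floor = certified bounds/negative ranges.
Census STRUCTURE bookkeeping of the STPP track (seat pub-omega-stpp-3, gen 25; STRUCTURE row B5, column `T2`), not progress on `ω`.

After the min-flag normal form of `STPPSmallPatternKernelReflect122R.lean` has fixed the start `(y, c'₀)`, the injective additive
maps FIXING BOTH `y` AND `c'₀` (and preserving the pair-class rank) still act on the solution: applying the one that minimises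
the code of some `B`-element of the triples `1, …, k−1` and re-sorting makes the code of `b₁` (the least such code) equal to
`minCode` of some element — the least code in its orbit under the listed maps.  Hence the second-level chunk masks `xb` of a
start need only admit the codes `minCode x`, `x ∈ G` (`not_exists_isSTPP_122_of_search2r_stab2`).  For `(ℤ/2)⁵` (one start,
`y = e₄`, `c'₀ = e₃` in codes `1, 2`) the maps of `GL₅(𝔽₂)` fixing both move every admissible `b₁` to the single code `4`:
one `b₁`-branch instead of `28`.

* `minCode E mkH L x` — the least code among `x` and its images `mkH j x`, `j ∈ L` (recursor form, kernel-evaluable);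
* `exists_NF2_fixAt_trackB` — the tracked sorting step of `…Reflect122R` with, in addition, the `B`-ELEMENTS tracked;
* `not_exists_isSTPP_122_of_search2r_stab2` — the reflection theorem.

References: H. Cohn, R. Kleinberg, B. Szegedy, C. Umans, FOCS 2005 (arXiv:math/0511460), Def. 5.1.  Record: pub-omega HOME
`pub-omega-stpp-3-g25/`.
-/

namespace Summit.MatrixMultiplication.OmegaCensus

namespace STPP122Neg

open STPP211Neg Literature.Computability.AlgebraicComplexity

section Refl

variable {G : Type} [AddCommGroup G] {E : GEnc G} {K : ℕ} {b b' c c' : Fin K → G}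

/-- The least code among `x` and its images under the listed maps `mkH j`, `j ∈ L`. -/
noncomputable def minCode {κ : Type*} (E : GEnc G) (mkH : κ → G → G) (L : List κ) (x : G) : ℕ :=
  @List.rec κ (fun _ => ℕ) (E.enc x) (fun j _ ih => min ih (E.enc (mkH j x))) L

/-- `minCode` on a cons. -/
theorem minCode_cons {κ : Type*} (E : GEnc G) (mkH : κ → G → G) (j : κ) (L : List κ) (x : G) :
    minCode E mkH (j :: L) x = min (minCode E mkH L x) (E.enc (mkH j x)) := rfl

/-- `minCode` is at most the code of the element itself. -/
theorem minCode_le_self {κ : Type*} (E : GEnc G) (mkH : κ → G → G) (L : List κ) (x : G) :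
    minCode E mkH L x ≤ E.enc x := by
  induction L with
  | nil => exact le_rfl
  | cons j L ih => rw [minCode_cons]; exact le_trans (min_le_left _ _) ih

/-- `minCode` is at most the code of every listed image. -/
theorem minCode_le_map {κ : Type*} (E : GEnc G) (mkH : κ → G → G) {L : List κ} {j : κ} (hj : j ∈ L) (x : G) :
    minCode E mkH L x ≤ E.enc (mkH j x) := by
  induction L with
  | nil => simp at hj
  | cons j' L ih =>
      rw [minCode_cons]
      rcases List.mem_cons.1 hj with rfl | hj
      · exact min_le_right _ _
      · exact le_trans (min_le_left _ _) (ih hj)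

/-- `minCode` is attained: by the element itself or by a listed image. -/
theorem minCode_eq {κ : Type*} (E : GEnc G) (mkH : κ → G → G) (L : List κ) (x : G) :
    minCode E mkH L x = E.enc x ∨ ∃ j ∈ L, minCode E mkH L x = E.enc (mkH j x) := by
  induction L with
  | nil => exact Or.inl rfl
  | cons j L ih =>
      rw [minCode_cons]
      rcases le_total (minCode E mkH L x) (E.enc (mkH j x)) with h | h
      · rw [min_eq_left h]
        rcases ih with h1 | ⟨j', hj', h2⟩
        · exact Or.inl h1
        · exact Or.inr ⟨j', List.mem_cons_of_mem _ hj', h2⟩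
      · rw [min_eq_right h]; exact Or.inr ⟨j, List.mem_cons_self, rfl⟩

/-- NORMAL FORM, TRACKED WITH ELEMENTS: as `exists_NF2_fixAt_track`, recording in addition that the `B`-pair of every new triple
`i` IS the `B`-pair of the old triple `σ i` (as a set). -/
theorem exists_NF2_fixAt_trackB (E : GEnc G) (hM : ModelD2 b b' c c') (hK : 0 < K) (i0 : Fin K) (hb0 : b i0 = 0)
    (hc0 : c i0 = 0) :
    ∃ p p' q q' : Fin K → G, ∃ σ : Fin K ≃ Fin K, ModelD2 p p' q q' ∧ NF2 E p p' q q' ∧ p ⟨0, hK⟩ = 0 ∧ q ⟨0, hK⟩ = 0 ∧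
      p' ⟨0, hK⟩ = b' i0 ∧ q' ⟨0, hK⟩ = c' i0 ∧ σ ⟨0, hK⟩ = i0 ∧
      (∀ i, SgnEq (p' i - p i) (b' (σ i) - b (σ i)) ∧ SgnEq (q' i - q i) (c' (σ i) - c (σ i))) ∧
      ∀ i, (p i = b (σ i) ∧ p' i = b' (σ i)) ∨ (p i = b' (σ i) ∧ p' i = b (σ i)) := by
  set j0 : Fin K := ⟨0, hK⟩
  set b2 : Fin K → G := fun i => if E.enc (b i) < E.enc (b' i) then b i else b' i
  set b2' : Fin K → G := fun i => if E.enc (b i) < E.enc (b' i) then b' i else b i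
  set c2 : Fin K → G := fun i => if E.enc (c i) < E.enc (c' i) then c i else c' i
  set c2' : Fin K → G := fun i => if E.enc (c i) < E.enc (c' i) then c' i else c i
  have hM2 : ModelD2 b2 b2' c2 c2' := hM.orient E
  have hB0 : E.enc (b i0) < E.enc (b' i0) := by
    rw [hb0, E.enc_zero]; refine Nat.pos_of_ne_zero fun h0 => hM.1 i0 ?_
    rw [hb0]; exact (E.enc_inj (h0.trans E.enc_zero.symm)).symm
  have hC0 : E.enc (c i0) < E.enc (c' i0) := by
    rw [hc0, E.enc_zero]; refine Nat.pos_of_ne_zero fun h0 => hM.2.1 i0 ?_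
    rw [hc0]; exact (E.enc_inj (h0.trans E.enc_zero.symm)).symm
  have hb2 : b2 i0 = 0 := by
    show (if E.enc (b i0) < E.enc (b' i0) then b i0 else b' i0) = 0
    rw [if_pos hB0, hb0]
  have hb2' : b2' i0 = b' i0 := by
    show (if E.enc (b i0) < E.enc (b' i0) then b' i0 else b i0) = _
    rw [if_pos hB0]
  have hc2 : c2 i0 = 0 := by
    show (if E.enc (c i0) < E.enc (c' i0) then c i0 else c' i0) = 0
    rw [if_pos hC0, hc0]
  have hc2' : c2' i0 = c' i0 := by
    show (if E.enc (c i0) < E.enc (c' i0) then c' i0 else c i0) = _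
    rw [if_pos hC0]
  have hlt2 : ∀ i, E.enc (b2 i) < E.enc (b2' i) ∧ E.enc (c2 i) < E.enc (c2' i) := by
    intro i
    have hne1 : E.enc (b i) ≠ E.enc (b' i) := fun e => hM.1 i (E.enc_inj e)
    have hne2 : E.enc (c i) ≠ E.enc (c' i) := fun e => hM.2.1 i (E.enc_inj e)
    constructor
    · show E.enc (if E.enc (b i) < E.enc (b' i) then b i else b' i) <
        E.enc (if E.enc (b i) < E.enc (b' i) then b' i else b i)
      split_ifs with h
      · exact h
      · omega
    · show E.enc (if E.enc (c i) < E.enc (c' i) then c i else c' i) <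
        E.enc (if E.enc (c i) < E.enc (c' i) then c' i else c i)
      split_ifs with h
      · exact h
      · omega
  have hsg : ∀ i, SgnEq (b2' i - b2 i) (b' i - b i) ∧ SgnEq (c2' i - c2 i) (c' i - c i) := fun i =>
    ⟨sgnEq_orient E (b i) (b' i), sgnEq_orient E (c i) (c' i)⟩
  have hel : ∀ i, (b2 i = b i ∧ b2' i = b' i) ∨ (b2 i = b' i ∧ b2' i = b i) := by
    intro i
    show ((if E.enc (b i) < E.enc (b' i) then b i else b' i) = b i ∧
        (if E.enc (b i) < E.enc (b' i) then b' i else b i) = b' i) ∨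
      ((if E.enc (b i) < E.enc (b' i) then b i else b' i) = b' i ∧
        (if E.enc (b i) < E.enc (b' i) then b' i else b i) = b i)
    split_ifs
    · exact Or.inl ⟨rfl, rfl⟩
    · exact Or.inr ⟨rfl, rfl⟩
  set σ := Tuple.sort (fun i => E.enc (b2 i))
  have hmono : Monotone ((fun i => E.enc (b2 i)) ∘ σ) := Tuple.monotone_sort _
  have hM3 : ModelD2 (b2 ∘ σ) (b2' ∘ σ) (c2 ∘ σ) (c2' ∘ σ) := hM2.reindex σ σ.injective
  have hinjb : Function.Injective (fun i => E.enc ((b2 ∘ σ) i)) := by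
    intro i j h
    have h' : b2 (σ i) = b2 (σ j) := E.enc_inj h
    have hin : InA b2 b2' (σ j) (b2 (σ i)) := by rw [h']; exact inA_p (σ j)
    exact σ.injective (hM2.b_disj (inA_p (σ i)) hin)
  have hsm : StrictMono (fun i => E.enc ((b2 ∘ σ) i)) := hmono.strictMono_of_injective hinjb
  have hσ0 : σ j0 = i0 := by
    have hle0 : j0 ≤ σ.symm i0 := by rw [Fin.le_def]; exact Nat.zero_le _
    have hle : E.enc (b2 (σ j0)) ≤ E.enc (b2 (σ (σ.symm i0))) := hmono hle0
    rw [Equiv.apply_symm_apply, hb2, E.enc_zero] at hle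
    have h00 : E.enc ((b2 ∘ σ) j0) = E.enc ((b2 ∘ σ) (σ.symm i0)) := by
      show E.enc (b2 (σ j0)) = E.enc (b2 (σ (σ.symm i0))); rw [Equiv.apply_symm_apply, hb2, E.enc_zero]; omega
    have h3 := congrArg σ (hinjb h00)
    rw [Equiv.apply_symm_apply] at h3
    exact h3
  refine ⟨b2 ∘ σ, b2' ∘ σ, c2 ∘ σ, c2' ∘ σ, σ, hM3,
    ⟨fun i j hij => hsm hij, fun i => (hlt2 (σ i)).1, fun i => (hlt2 (σ i)).2⟩, ?_, ?_, ?_, ?_, hσ0, fun i => hsg (σ i),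
    fun i => hel (σ i)⟩
  · show b2 (σ j0) = 0; rw [hσ0, hb2]
  · show c2 (σ j0) = 0; rw [hσ0, hc2]
  · show b2' (σ j0) = b' i0; rw [hσ0, hb2']
  · show c2' (σ j0) = c' i0; rw [hσ0, hc2']

/-- THE SECOND STABILISER LEVEL: a min-flag normal form `(r, r', s, s')` (start `(Y, Z)`, every triple of rank `≥ rank (Y, Z)` in
both orders) can be moved by an injective additive rank-preserving map fixing `Y` and `Z` (one of the listed `mkH j`, `j ∈ L`, or
the identity) and re-sorted so that, in addition, the code of `b₁` is `minCode E mkH L x` for some `x`. -/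
theorem exists_NF2_minCode {κ : Type*} (E : GEnc G) {r r' s s' : Fin K → G} (hMr : ModelD2 r r' s s')
    (hK : 2 ≤ K) (hr0 : r ⟨0, by omega⟩ = 0) (hs0 : s ⟨0, by omega⟩ = 0) (pr : G → G → ℕ)
    (hnegl : ∀ u v, pr (-u) v = pr u v) (hnegr : ∀ u v, pr u (-v) = pr u v)
    (hle : ∀ i, pr (r' ⟨0, by omega⟩) (s' ⟨0, by omega⟩) ≤ pr (r' i - r i) (s' i - s i) ∧
      pr (r' ⟨0, by omega⟩) (s' ⟨0, by omega⟩) ≤ pr (s' i - s i) (r' i - r i))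
    (mkH : κ → G → G) (L : List κ) (hadd : ∀ j ∈ L, ∀ a b : G, mkH j (a + b) = mkH j a + mkH j b)
    (hker : ∀ j ∈ L, ∀ x : G, mkH j x = 0 → x = 0) (hpr : ∀ j ∈ L, ∀ u v, pr (mkH j u) (mkH j v) = pr u v)
    (hfix : ∀ j ∈ L, mkH j (r' ⟨0, by omega⟩) = r' ⟨0, by omega⟩ ∧ mkH j (s' ⟨0, by omega⟩) = s' ⟨0, by omega⟩) :
    ∃ t t' u u' : Fin K → G, ModelD2 t t' u u' ∧ NF2 E t t' u u' ∧ t ⟨0, by omega⟩ = 0 ∧ u ⟨0, by omega⟩ = 0 ∧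
      t' ⟨0, by omega⟩ = r' ⟨0, by omega⟩ ∧ u' ⟨0, by omega⟩ = s' ⟨0, by omega⟩ ∧
      (∀ i, pr (t' ⟨0, by omega⟩) (u' ⟨0, by omega⟩) ≤ pr (t' i - t i) (u' i - u i) ∧
        pr (t' ⟨0, by omega⟩) (u' ⟨0, by omega⟩) ≤ pr (u' i - u i) (t' i - t i)) ∧
      ∃ x : G, E.enc (t ⟨1, hK⟩) = minCode E mkH L x := by
  classical
  have hK1 : 0 < K := by omega
  set i0 : Fin K := ⟨0, hK1⟩
  set i1 : Fin K := ⟨1, hK⟩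
  -- the element of least `minCode` among the B-elements of the triples ≠ 0
  set el : Fin K × Bool → G := fun ib => if ib.2 then r' ib.1 else r ib.1
  set F : Finset (Fin K × Bool) := Finset.univ.filter fun ib => ib.1 ≠ i0
  have hFne : F.Nonempty := ⟨(i1, false), by simp [F, i0, i1, Fin.ext_iff]⟩
  obtain ⟨ibm, hibm, hmin⟩ := F.exists_min_image (fun ib => minCode E mkH L (el ib)) hFne
  have hibm0 : ibm.1 ≠ i0 := (Finset.mem_filter.1 hibm).2
  -- the minimising map: the identity or a listed map
  obtain ⟨φ, hφinj, hφpr, hφY, hφZ, hφL, hφm⟩ : ∃ φ : G →+ G, Function.Injective φ ∧ (∀ u v, pr (φ u) (φ v) = pr u v) ∧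
      φ (r' i0) = r' i0 ∧ φ (s' i0) = s' i0 ∧ (∀ x, minCode E mkH L x ≤ E.enc (φ x)) ∧
      E.enc (φ (el ibm)) = minCode E mkH L (el ibm) := by
    rcases minCode_eq E mkH L (el ibm) with h | ⟨j, hj, h⟩
    · exact ⟨AddMonoidHom.id G, fun a b h => h, fun u v => rfl, rfl, rfl, fun x => minCode_le_self E mkH L x, h.symm⟩
    · exact ⟨AddMonoidHom.mk' (mkH j) (hadd j hj), injective_of_additive_of_ker (hadd j hj) (hker j hj), hpr j hj,
        (hfix j hj).1, (hfix j hj).2, fun x => minCode_le_map E mkH hj x, h.symm⟩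
  -- apply φ and re-sort
  have hM3 : ModelD2 (fun i => φ (r i)) (fun i => φ (r' i)) (fun i => φ (s i)) (fun i => φ (s' i)) := hMr.map φ hφinj
  obtain ⟨t, t', u, u', σ, hMt, hNFt, ht0, hu0, ht', hu', hσ0, htr, hel⟩ :=
    exists_NF2_fixAt_trackB E hM3 hK1 i0 (by show φ (r i0) = 0; rw [hr0, map_zero]) (by show φ (s i0) = 0; rw [hs0, map_zero])
  have ht'0 : t' i0 = r' i0 := by rw [ht']; exact hφY
  have hu'0 : u' i0 = s' i0 := by rw [hu']; exact hφZ
  refine ⟨t, t', u, u', hMt, hNFt, ht0, hu0, ht'0, hu'0, fun i => ?_, ⟨el ibm, le_antisymm ?_ ?_⟩⟩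
  · -- ranks: every new triple is an old one through φ, up to signs
    have hB : SgnEq (t' i - t i) (φ (r' (σ i) - r (σ i))) := by
      have e1 : φ (r' (σ i)) - φ (r (σ i)) = φ (r' (σ i) - r (σ i)) := (AddMonoidHom.map_sub φ _ _).symm
      rw [← e1]; exact (htr i).1
    have hC : SgnEq (u' i - u i) (φ (s' (σ i) - s (σ i))) := by
      have e1 : φ (s' (σ i)) - φ (s (σ i)) = φ (s' (σ i) - s (σ i)) := (AddMonoidHom.map_sub φ _ _).symm
      rw [← e1]; exact (htr i).2
    rw [ht'0, hu'0, SgnEq.pr_eq hnegl hnegr hB hC, SgnEq.pr_eq hnegl hnegr hC hB, hφpr, hφpr]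
    exact hle (σ i)
  · -- `enc (t 1) ≤ minCode (el ibm)`: the image `φ (el ibm)` is a B-element of the new triple `σ⁻¹ ibm.1 ≠ 0`
    set l : Fin K := σ.symm ibm.1
    have hl0 : l ≠ i0 := fun h => hibm0 (by
      have e1 : σ l = ibm.1 := Equiv.apply_symm_apply σ _
      rw [← e1, h]; exact hσ0)
    have hl1 : i1 ≤ l := by
      rw [Fin.le_def]; show 1 ≤ l.val
      by_contra h
      exact hl0 (Fin.ext (by simp [i0]; omega))
    have hmem : φ (el ibm) = t l ∨ φ (el ibm) = t' l := by
      have hσl : σ l = ibm.1 := Equiv.apply_symm_apply σ _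
      rcases hel l with ⟨h1, h2⟩ | ⟨h1, h2⟩
      · rw [h1, h2, hσl]
        obtain ⟨i, bb⟩ := ibm
        cases bb
        · exact Or.inl rfl
        · exact Or.inr rfl
      · rw [h1, h2, hσl]
        obtain ⟨i, bb⟩ := ibm
        cases bb
        · exact Or.inr rfl
        · exact Or.inl rfl
    have h1 : E.enc (t l) ≤ E.enc (φ (el ibm)) := by
      rcases hmem with h | h
      · rw [h]
      · rw [h]; exact le_of_lt (hNFt.2.1 l)
    have h2 : E.enc (t i1) ≤ E.enc (t l) := by
      rcases eq_or_lt_of_le hl1 with h | h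
      · rw [h]
      · exact le_of_lt (hNFt.1 i1 l h)
    rw [← hφm]; exact le_trans h2 h1
  · -- `minCode (el ibm) ≤ enc (t 1)`: `t 1` is the `φ`-image of a B-element of an old triple `≠ 0`
    have hσ1 : σ i1 ≠ i0 := fun h => by
      have : i1 = i0 := σ.injective (h.trans hσ0.symm)
      simp [i0, i1, Fin.ext_iff] at this
    obtain ⟨x, hxF, hx⟩ : ∃ ib ∈ F, t i1 = φ (el ib) := by
      rcases hel i1 with ⟨h1, -⟩ | ⟨h1, -⟩
      · exact ⟨(σ i1, false), Finset.mem_filter.2 ⟨Finset.mem_univ _, hσ1⟩, h1⟩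
      · exact ⟨(σ i1, true), Finset.mem_filter.2 ⟨Finset.mem_univ _, hσ1⟩, h1⟩
    rw [hx]
    exact le_trans (hmin x hxF) (hφL (el x))

/-- **REFLECTION THROUGH DEF. 5.1 — MIN-FLAG NORMAL FORM WITH A SECOND STABILISER LEVEL** (pattern `(1,2,2)^k`, `k ≥ 2`): as
`not_exists_isSTPP_122_of_search2r`, with, for every certified start `s`, a list `IH s` of maps `mkH j` that are additive,
kernel-trivial, rank-preserving and FIX BOTH ELEMENTS OF THE START; the chunk masks of the start then need only cover the pairs
`(minCode x, v₂)` — the least code in the orbit of `x` under `IH s`, any `b'₁`-code `v₂`.  [cite: CohnKleinbergSzegedyUmans2005, Def. 5.1] -/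
theorem not_exists_isSTPP_122_of_search2r_stab2 [DecidableEq G] (E : GEnc G) (hK : 2 ≤ K) (cls : List ℕ)
    (hneg : ∀ u v : G, prk E cls (-u) v = prk E cls u v ∧ prk E cls u (-v) = prk E cls u v)
    {reps : List ℕ} {ι κ κ' : Type*} (mkA : ι → G → G) (IA : List ι)
    (haddA : ∀ i ∈ IA, ∀ a b : G, mkA i (a + b) = mkA i a + mkA i b) (hkerA : ∀ i ∈ IA, ∀ x : G, mkA i x = 0 → x = 0)
    (hcover : ∀ d : G, d ≠ 0 → ∃ i ∈ IA, E.enc (mkA i d) ∈ reps)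
    (hprA : ∀ i ∈ IA, ∀ u v : G, prk E cls (mkA i u) (mkA i v) = prk E cls u v)
    (mkS : κ → G → G) (IS : List κ)
    (haddS : ∀ j ∈ IS, ∀ a b : G, mkS j (a + b) = mkS j a + mkS j b) (hkerS : ∀ j ∈ IS, ∀ x : G, mkS j x = 0 → x = 0)
    (hprS : ∀ j ∈ IS, ∀ u v : G, prk E cls (mkS j u) (mkS j v) = prk E cls u v)
    (mkH : κ' → G → G) (IH : ℕ × ℕ → List κ')
    {starts : List (ℕ × ℕ)}
    (hH : ∀ s ∈ starts, ∀ j ∈ IH s, (∀ a b : G, mkH j (a + b) = mkH j a + mkH j b) ∧ (∀ x : G, mkH j x = 0 → x = 0) ∧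
      (∀ u v : G, prk E cls (mkH j u) (mkH j v) = prk E cls u v) ∧
      ∀ d w : G, E.enc d = s.1 → E.enc w = s.2 → mkH j d = d ∧ mkH j w = w)
    (hstab : ∀ d : G, E.enc d ∈ reps → ∀ z : G, ∃ j ∈ IS, mkS j d = d ∧
      (prk E cls (mkS j z) d < prk E cls d (mkS j z) ∨ (E.enc d, E.enc (mkS j z)) ∈ starts))
    (hcov : ∀ s ∈ starts, ∃ ch : List (ℕ × ℕ × ℕ × ℕ × ℕ × ℕ × ℕ), search2r E.g K ch = true ∧
      (∀ e ∈ ch, e.1 = s.1 ∧ e.2.1 = s.2 ∧ ∀ u < E.g.n, ∀ v < E.g.n,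
        (0 < u ∧ 0 < v ∧ prank cls (e.1 * E.g.n + e.2.1) ≤ prank cls (u * E.g.n + v) ∧
          prank cls (e.1 * E.g.n + e.2.1) ≤ prank cls (v * E.g.n + u)) →
        e.2.2.2.2.1.testBit u = false ∧ e.2.2.2.2.2.1.testBit v = false ∧ e.2.2.2.2.2.2.testBit (u * E.g.n + v) = false) ∧
      ∀ x : G, ∀ v₂ < E.g.n, ∃ e ∈ ch, e.2.2.1.testBit (minCode E mkH (IH s) x) = false ∧ e.2.2.2.1.testBit v₂ = false) :
    ¬ ∃ A B C : Fin K → Finset G, IsSTPP A B C ∧ ∀ i, (A i).card = 1 ∧ (B i).card = 2 ∧ (C i).card = 2 := by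
  have hK1 : 0 < K := by omega
  rw [exists_isSTPP_122_iff]
  rintro ⟨p, p', q, q', hb, hc, hU, hX⟩
  have hM : ModelD2 p p' q q' := modelD2_of_finsetForm hb hc hU hX
  -- homs from the parametrised maps
  have haddLA : ∀ f ∈ IA.map mkA, ∀ a b : G, f (a + b) = f a + f b := fun f hf => by
    obtain ⟨i, hi, rfl⟩ := List.mem_map.1 hf; exact haddA i hi
  have haddLS : ∀ f ∈ IS.map mkS, ∀ a b : G, f (a + b) = f a + f b := fun f hf => by
    obtain ⟨j, hj, rfl⟩ := List.mem_map.1 hf; exact haddS j hj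
  set LA : List (G →+ G) := (IA.map mkA).attach.map fun x => AddMonoidHom.mk' x.1 (haddLA x.1 x.2)
  set LS : List (G →+ G) := (IS.map mkS).attach.map fun x => AddMonoidHom.mk' x.1 (haddLS x.1 x.2)
  have memLA : ∀ i ∈ IA, ∃ φ ∈ LA, ⇑φ = mkA i := fun i hi =>
    exists_mem_attach_map haddLA (List.mem_map.2 ⟨i, hi, rfl⟩)
  have memLS : ∀ j ∈ IS, ∃ φ ∈ LS, ⇑φ = mkS j := fun j hj =>
    exists_mem_attach_map haddLS (List.mem_map.2 ⟨j, hj, rfl⟩)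
  have hinjA : ∀ φ ∈ LA, Function.Injective φ := fun φ hφ => by
    obtain ⟨f, hf, hφf⟩ := coe_mem_of_mem_attach_map hφ
    obtain ⟨i, hi, rfl⟩ := List.mem_map.1 hf
    rw [hφf]; exact injective_of_additive_of_ker (haddA i hi) (hkerA i hi)
  have hinjS : ∀ φ ∈ LS, Function.Injective φ := fun φ hφ => by
    obtain ⟨f, hf, hφf⟩ := coe_mem_of_mem_attach_map hφ
    obtain ⟨j, hj, rfl⟩ := List.mem_map.1 hf
    rw [hφf]; exact injective_of_additive_of_ker (haddS j hj) (hkerS j hj)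
  have hprLA : ∀ φ ∈ LA, ∀ u v, prk E cls (φ u) (φ v) = prk E cls u v := fun φ hφ u v => by
    obtain ⟨f, hf, hφf⟩ := coe_mem_of_mem_attach_map hφ
    obtain ⟨i, hi, rfl⟩ := List.mem_map.1 hf
    rw [hφf]; exact hprA i hi u v
  have hprLS : ∀ φ ∈ LS, ∀ u v, prk E cls (φ u) (φ v) = prk E cls u v := fun φ hφ u v => by
    obtain ⟨f, hf, hφf⟩ := coe_mem_of_mem_attach_map hφ
    obtain ⟨j, hj, rfl⟩ := List.mem_map.1 hf
    rw [hφf]; exact hprS j hj u v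
  have hcoverA : ∀ d : G, d ≠ 0 → ∃ φ ∈ LA, E.enc (φ d) ∈ reps := fun d hd => by
    obtain ⟨i, hi, h⟩ := hcover d hd
    obtain ⟨φ, hφ, hφf⟩ := memLA i hi
    exact ⟨φ, hφ, by rw [hφf]; exact h⟩
  -- the min-flag normal form
  obtain ⟨r, r', s, s', hMr, hNF, hr0, hs0, -, hgood, hle⟩ := exists_normalForm2_rank E hM hK1 (prk E cls)
    (fun u v => (hneg u v).1) (fun u v => (hneg u v).2) hinjA hcoverA hprLA hinjS hprLS
    (good := fun y w => prank cls (w * E.g.n + y) < prank cls (y * E.g.n + w) ∨ (y, w) ∈ starts) (fun d hd z => by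
      obtain ⟨j, hj, hjd, hrest⟩ := hstab d hd z
      obtain ⟨ψ, hψ, hψg⟩ := memLS j hj
      refine ⟨ψ, hψ, by rw [hψg]; exact hjd, ?_⟩
      rw [hψg]; exact hrest)
  set i0 : Fin K := ⟨0, hK1⟩
  rcases hgood with hlt | hmem
  · have h := (hle i0).2
    rw [hr0, hs0, sub_zero, sub_zero] at h
    exact absurd hlt (not_lt.2 h)
  · -- second stabiliser level at the certified start
    set st : ℕ × ℕ := (E.enc (r' i0), E.enc (s' i0))
    have hHs := hH st hmem
    obtain ⟨t, t', u, u', hMt, hNFt, ht0, hu0, ht'0, hu'0, hlet, x, hx⟩ := exists_NF2_minCode E hMr hK hr0 hs0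
      (prk E cls) (fun u v => (hneg u v).1) (fun u v => (hneg u v).2) hle mkH (IH st) (fun j hj => (hHs j hj).1)
      (fun j hj => (hHs j hj).2.1) (fun j hj => (hHs j hj).2.2.1) (fun j hj => (hHs j hj).2.2.2 _ _ rfl rfl)
    obtain ⟨ch, hsearch, hall, hcover2⟩ := hcov st hmem
    obtain ⟨e, he, hx1, hx2⟩ := hcover2 x (E.enc (t' ⟨1, hK⟩)) (E.enc_lt _)
    obtain ⟨he1, he2, had'⟩ := hall e he
    have had : Adequate E.g.n cls e := fun u hu0 hu v hv0 hv h1 h2 => had' u hu v hv ⟨hu0, hv0, h1, h2⟩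
    have he1' : e.1 = E.enc (t' i0) := by rw [he1, ht'0]
    have he2' : e.2.1 = E.enc (u' i0) := by rw [he2, hu'0]
    have hP : PairOK E e.2.2.2.2.1 e.2.2.2.2.2.1 e.2.2.2.2.2.2 t t' u u' := pairOK_of_adequate hMt hK1 hlet he1' he2' had
    rw [← hx] at hx1
    have := start2r_of_search2r hsearch e he
    rw [he1', he2', start2r_false hMt hNFt hP hK ht0 hu0 hx1 hx2] at this
    exact Bool.false_ne_true this

end Refl

end STPP122Neg

end Summit.MatrixMultiplication.OmegaCensus
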